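import Summits.QuantumAdvantage.QuantumAdvantage.Theses.WhiteBoxWalk
import Literature.Computability.QuantumComplexity.SinkOfVerifiableLine
import Literature.Computability.QuantumComplexity.ExactQuantumQuery

/-!
# `WbwVerifiableLineNoSpeedup` (stmt-QuantumAdvantage-2239) — negative / calibration lemmas, I: load-bearing hypotheses

Support lemmas for the crux `WhiteBoxWalk.WbwVerifiableLineNoSpeedup`
(`∃ c > 0, ∀ m T, 2 ≤ m → 1 ≤ T → T + 1 ≤ 2^(m-1) → c · min (T+1) √(2^m) / m ≤ Q_{1/3}(SVL_{m,T})`,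
`Q_{1/3}` = `quantumQueryComplexityOn (1/3) (svlPromise m T) (svlSinkBit m T)`), extracted from
the refuter work file `Summits/QuantumAdvantage/QuantumAdvantage/Cruxes/WbwVerifiableLineNoSpeedup/
Disproof.lean` (cycle 1, refuter-cdisprove-stmt-QuantumAdvantage-2239-0) so that provers, planners
and ideators can IMPORT them. Sorry-free; no statement of the route is asserted positively.

* §0 `crux_iff` — the crux over the named tables (`Iff.rfl`); `svlQ m T` the bounded quantity.
* §1 `two_le_of_hyps` — the hypothesis `2 ≤ m` is implied by the other two (decoration);
  `succ_succ_le_two_pow_of_hyps` — the hypotheses leave room for a sink of either parity.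
* §2 zero-query algorithms: `quantumQueryComplexityOn_eq_zero_of_forall_eq_false`,
  `quantumQueryComplexityOn_empty`, `acceptProb_eq_of_queries_eq_zero`,
  `one_le_quantumQueryComplexityOn_of_nonconst` (general facts about the tree's query model);
  `svlQ_zero_right` (`Q(m,0) = 0`), `svlQ_eq_zero_of_two_pow_lt` (`Q = 0` on the empty promise).
  LOAD-BEARING: `wbwVerifiableLineNoSpeedup_false_without_Tpos` (drop `1 ≤ T` ⇒ false at
  `(m,T) = (2,0)`), `wbwVerifiableLineNoSpeedup_false_without_Tbound` (drop `T + 1 ≤ 2^(m-1)` ⇒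
  false at `(2,4)`, empty promise).

Sequel: `Tightness.lean` (`Q ≥ 1` pointwise — the quantifier-swapped crux is true —, `Q ≤ m·T`,
`Q(m,1) = 1`, admissible `c ≤ 1`, the Grover-branch-only strengthening is false).
-/

noncomputable section

set_option linter.dupNamespace false

namespace Summit.QuantumAdvantage.QuantumAdvantage.Theorems.WbwVerifiableLineNoSpeedup.Negative

open Literature.Computability.Cryptography Literature.Computability.QuantumComplexity
  Literature.Computability.Complexity
open Summit.QuantumAdvantage.QuantumAdvantage.Theses.WhiteBoxWalk (WbwVerifiableLineNoSpeedup)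

/-! ## §0 The crux over the named tables -/

/-- The quantity bounded by the crux: the bounded-error quantum query complexity of the sink bit
of black-box SVL with `m`-bit names and `T` steps. [folklore] -/
abbrev svlQ (m T : ℕ) : ℕ := quantumQueryComplexityOn (1 / 3) (svlPromise m T) (svlSinkBit m T)

/-- The crux is, by `Iff.rfl`, the statement over `svlPromise` / `svlSinkBit`
(`svlPromise_eq`, `svlSinkBit_eq` are `rfl`). [folklore] -/
theorem crux_iff :
    WbwVerifiableLineNoSpeedup ↔
      ∃ c : ℝ, 0 < c ∧ ∀ m T : ℕ, 2 ≤ m → 1 ≤ T → T + 1 ≤ 2 ^ (m - 1) →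
        c * min ((T : ℝ) + 1) (Real.sqrt (2 ^ m)) / m ≤ (svlQ m T : ℝ) :=
  Iff.rfl

/-! ## §1 Hypothesis bookkeeping -/

/-- The hypothesis `2 ≤ m` of the crux is implied by the other two (`m = 0, 1` force `T = 0`):
it is decoration. [folklore] -/
theorem two_le_of_hyps {m T : ℕ} (hT : 1 ≤ T) (hTm : T + 1 ≤ 2 ^ (m - 1)) : 2 ≤ m := by
  rcases Nat.lt_or_ge m 2 with hm | hm
  · interval_cases m <;> simp at hTm <;> omega
  · exact hm

/-- Under the crux's hypotheses there is room for a sink of either parity: `T + 2 ≤ 2^m`. [folklore] -/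
theorem succ_succ_le_two_pow_of_hyps {m T : ℕ} (hT : 1 ≤ T) (hTm : T + 1 ≤ 2 ^ (m - 1)) :
    T + 2 ≤ 2 ^ m := by
  have hm := two_le_of_hyps hT hTm
  have h2 : 2 ^ m = 2 * 2 ^ (m - 1) := by
    rw [← Nat.pow_succ']
    congr 1
    omega
  have h1 : 1 ≤ 2 ^ (m - 1) := Nat.one_le_two_pow
  omega

/-- In particular `T + 1 ≤ 2^m` (the promise set is nonempty, `svlPromise_nonempty`). [folklore] -/
theorem succ_le_two_pow_of_hyps {m T : ℕ} (hT : 1 ≤ T) (hTm : T + 1 ≤ 2 ^ (m - 1)) :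
    T + 1 ≤ 2 ^ m :=
  (Nat.le_succ _).trans (succ_succ_le_two_pow_of_hyps hT hTm)

/-! ## §2 Zero-query algorithms; the two load-bearing hypotheses -/

/-- The input length `2^m·m + 2^m·(T+1)` is positive. [folklore] -/
theorem inputLen_pos (m T : ℕ) : 0 < 2 ^ m * m + 2 ^ m * (T + 1) :=
  Nat.add_pos_right _ (Nat.mul_pos (Nat.two_pow_pos m) (Nat.succ_pos T))

/-- `NeZero` instance for the SVL input length. [folklore] -/
instance instNeZeroSvlLen (m T : ℕ) : NeZero (2 ^ m * m + 2 ^ m * (T + 1)) :=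
  ⟨(inputLen_pos m T).ne'⟩

/-- The zero-query algorithm that rejects everything (Beals et al. 2001, §2: `T = 0` queries,
empty accepting set). [folklore] -/
def constAlg (N : ℕ) [NeZero N] : QQueryAlg N where
  W := Unit
  queries := 0
  unitaries := fun _ => 1
  start := (0, false, ())
  accept := ∅

/-- `constAlg` never accepts. [folklore] -/
theorem constAlg_acceptProb (N : ℕ) [NeZero N] (x : Fin N → Bool) :
    (constAlg N).acceptProb x = 0 := by
  classical
  unfold QQueryAlg.acceptProb
  refine Finset.sum_eq_zero fun s hs => ?_
  rw [Finset.mem_filter] at hs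
  exact absurd hs.2 (Set.notMem_empty s)

/-- A function that is `false` on all of `D` has `Q_ε(D, f) = 0` for every `ε ≥ 0`
(zero queries: reject). [folklore] -/
theorem quantumQueryComplexityOn_eq_zero_of_forall_eq_false {N : ℕ} [NeZero N] {ε : ℝ}
    (hε : 0 ≤ ε) {D : Set (Fin N → Bool)} {f : (Fin N → Bool) → Bool}
    (hf : ∀ x ∈ D, f x = false) : quantumQueryComplexityOn ε D f = 0 := by
  apply Nat.eq_zero_of_le_zero
  refine Nat.sInf_le ⟨constAlg N, rfl, fun x hx => ⟨fun hfx => ?_, fun _ => ?_⟩⟩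
  · rw [hf x hx] at hfx
    exact absurd hfx Bool.false_ne_true
  · rw [constAlg_acceptProb]
    exact hε

/-- On the EMPTY promise set every function has `Q_ε = 0` (`ε ≥ 0`). [folklore] -/
theorem quantumQueryComplexityOn_empty {N : ℕ} [NeZero N] {ε : ℝ} (hε : 0 ≤ ε)
    (f : (Fin N → Bool) → Bool) : quantumQueryComplexityOn ε (∅ : Set (Fin N → Bool)) f = 0 :=
  quantumQueryComplexityOn_eq_zero_of_forall_eq_false hε fun _ h => absurd h (Set.notMem_empty _)

/-- A zero-query algorithm has an input-independent final state. [folklore] -/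
theorem finalState_eq_of_queries_eq_zero {N : ℕ} (A : QQueryAlg N) (h : A.queries = 0)
    (x y : Fin N → Bool) : A.finalState x = A.finalState y := by
  cases A with
  | mk W q U s acc =>
    simp only at h
    subst h
    simp [QQueryAlg.finalState]

/-- A zero-query algorithm has an input-independent acceptance probability. [folklore] -/
theorem acceptProb_eq_of_queries_eq_zero {N : ℕ} (A : QQueryAlg N) (h : A.queries = 0)
    (x y : Fin N → Bool) : A.acceptProb x = A.acceptProb y := by
  unfold QQueryAlg.acceptProb
  rw [finalState_eq_of_queries_eq_zero A h x y]

/-- If `f` takes both values on `D` then no zero-query algorithm computes it with error `1/3`;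
hence `1 ≤ Q_{1/3}(D, f)` (the defining infimum is attained,
`exists_queries_eq_quantumQueryComplexityOn`). [folklore] -/
theorem one_le_quantumQueryComplexityOn_of_nonconst {N : ℕ} [NeZero N] {D : Set (Fin N → Bool)}
    {f : (Fin N → Bool) → Bool} {x₀ x₁ : Fin N → Bool} (hx₀ : x₀ ∈ D) (hx₁ : x₁ ∈ D)
    (hf₀ : f x₀ = false) (hf₁ : f x₁ = true) : 1 ≤ quantumQueryComplexityOn (1 / 3) D f := by
  by_contra hlt
  push Not at hlt
  have h0 : quantumQueryComplexityOn (1 / 3) D f = 0 := Nat.lt_one_iff.1 hlt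
  obtain ⟨A, hAq, hA⟩ :=
    exists_queries_eq_quantumQueryComplexityOn (by norm_num : (0 : ℝ) ≤ 1 / 3) D f
  rw [h0] at hAq
  have h1 := (hA x₁ hx₁).1 hf₁
  have h2 := (hA x₀ hx₀).2 hf₀
  rw [acceptProb_eq_of_queries_eq_zero A hAq x₁ x₀] at h1
  linarith

/-- At `T = 0` the sink is the source `x₀ = 0`, so the sink bit is `false` on the whole promise. [folklore] -/
theorem svlSinkBit_eq_false_of_T_zero {m : ℕ} {t : SVLInput m 0} (ht : t ∈ svlPromise m 0) :
    svlSinkBit m 0 t = false := by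
  obtain ⟨xs, hxs⟩ := ht
  rw [hxs.svlSinkBit_eq, show Fin.last 0 = 0 from rfl, hxs.source]
  decide

/-- Hence `Q(m, 0) = 0` for every `m`. [folklore] -/
theorem svlQ_zero_right (m : ℕ) : svlQ m 0 = 0 :=
  quantumQueryComplexityOn_eq_zero_of_forall_eq_false (by norm_num) fun _ ht =>
    svlSinkBit_eq_false_of_T_zero ht

/-- And `Q(m, T) = 0` whenever `2^m < T + 1` (empty promise). [folklore] -/
theorem svlQ_eq_zero_of_two_pow_lt {m T : ℕ} (h : 2 ^ m < T + 1) : svlQ m T = 0 := by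
  unfold svlQ
  rw [svlPromise_eq_empty h]
  exact quantumQueryComplexityOn_empty (by norm_num) _

/-- **Load-bearing: `1 ≤ T`.** The crux with the hypothesis `1 ≤ T` dropped is false: witness
`(m, T) = (2, 0)`, where `Q = 0` but `c · min 1 2 / 2 = c/2 > 0`. Any proof must use `1 ≤ T`
(it is what makes the sink bit non-constant). [folklore] -/
theorem wbwVerifiableLineNoSpeedup_false_without_Tpos :
    ¬ ∃ c : ℝ, 0 < c ∧ ∀ m T : ℕ, 2 ≤ m → T + 1 ≤ 2 ^ (m - 1) →
      c * min ((T : ℝ) + 1) (Real.sqrt (2 ^ m)) / m ≤ (svlQ m T : ℝ) := by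
  rintro ⟨c, hc, h⟩
  have h20 := h 2 0 le_rfl (by norm_num)
  rw [svlQ_zero_right] at h20
  have hs : Real.sqrt (2 ^ 2) = 2 := Real.sqrt_sq (by norm_num)
  have hmin : min ((0 : ℕ) + 1 : ℝ) (Real.sqrt (2 ^ 2)) = 1 := by
    rw [hs]
    exact (min_eq_left (by norm_num)).trans (by norm_num)
  rw [hmin] at h20
  norm_num at h20
  linarith

/-- **Load-bearing: `T + 1 ≤ 2^(m-1)`** (in the weak sense that SOME upper bound `T + 1 ≤ 2^m`
is needed). The crux with this hypothesis dropped is false: witness `(m, T) = (2, 4)`, where the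
promise set is empty (no simple line with `5` vertices among `4` names), `Q = 0`, but
`c · min 5 2 / 2 = c > 0`. [folklore] -/
theorem wbwVerifiableLineNoSpeedup_false_without_Tbound :
    ¬ ∃ c : ℝ, 0 < c ∧ ∀ m T : ℕ, 2 ≤ m → 1 ≤ T →
      c * min ((T : ℝ) + 1) (Real.sqrt (2 ^ m)) / m ≤ (svlQ m T : ℝ) := by
  rintro ⟨c, hc, h⟩
  have h24 := h 2 4 le_rfl (by norm_num)
  rw [svlQ_eq_zero_of_two_pow_lt (by norm_num)] at h24
  have hs : Real.sqrt (2 ^ 2) = 2 := Real.sqrt_sq (by norm_num)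
  have hmin : min ((4 : ℕ) + 1 : ℝ) (Real.sqrt (2 ^ 2)) = 2 := by
    rw [hs]
    exact min_eq_right (by norm_num)
  rw [hmin] at h24
  norm_num at h24
  linarith

end Summit.QuantumAdvantage.QuantumAdvantage.Theorems.WbwVerifiableLineNoSpeedup.Negative
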